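import Literature.AlgebraicGeometry.HodgeTheory.HodgeClassOfMorphismDuality
import Literature.AlgebraicGeometry.HodgeTheory.ComplexOrientationFamily
import HarnessLib

/-!
# Route AmpleAdicLefschetz — crux `ThickDescent` (stmt-HodgeConjecture-2613), stub
# `stub_transversal_aboveMiddle`: above the middle degree, a pull-back orthogonal to all
# pull-backs vanishes

For a morphism `f : Y ⟶ X` of complex varieties with `Y` smooth projective of dimension `m`,
degrees `2p + k = 2m`, and a class `x ∈ H^{2p}(X(ℂ); ℂ)`: if the pull-back
`f^* : Hᵏ(X(ℂ); ℂ) → Hᵏ(Y(ℂ); ℂ)` is SURJECTIVE (above the middle of `Y` this is the weak Lefschetz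
theorem, supplied by a sibling stub as a hypothesis here) and `f^* x ∪ f^* y = 0` for every
`y ∈ Hᵏ(X(ℂ); ℂ)`, then `f^* x = 0`.

Indeed `f^* x ∪ w = 0` for EVERY `w ∈ Hᵏ(Y(ℂ); ℂ)` (each `w` is some `f^* y`), so the linear
functional `w ↦ ⟨f^* x ∪ w, [Y(ℂ)]⟩` vanishes; the cup product pairing
`H^{2p}(Y(ℂ); ℂ) × Hᵏ(Y(ℂ); ℂ) → ℂ` of the closed oriented `2m`-manifold `Y(ℂ)` is perfect
(A. Hatcher, *Algebraic Topology* (2002), §3.3 Prop. 3.38; on the tree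
`isPerfPair_cupPairing_complexPoints` for the complex orientation family
`complexOrientationFamily`), in particular its left map `u ↦ ⟨u ∪ ·, [Y(ℂ)]⟩` is injective, whence
`f^* x = 0`.

Everything used is PROVED on the tree; no named fact is introduced.

## References

* [HatcherAT2002] A. Hatcher, Algebraic Topology, CUP 2002, §3.3 Prop. 3.38.
* [VoisinHodgeII2003] C. Voisin, Hodge Theory and Complex Algebraic Geometry II, CUP 2003,
  §1.2.2 Thm. 1.23 (Lefschetz hyperplane theorem, the source of the surjectivity hypothesis).
-/

noncomputable section

-- every declaration of this problem lives in `Summit.HodgeConjecture.HodgeConjecture.…` (summit = sub-problem)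
set_option linter.dupNamespace false

namespace Summit.HodgeConjecture.HodgeConjecture.Theorems

open CategoryTheory AlgebraicGeometry
open Literature.AlgebraicGeometry Literature.AlgebraicGeometry.Motives Literature.AlgebraicGeometry.HodgeTheory
open Literature.AlgebraicTopology.SingularHomology Literature.Geometry.Kaehler

/-! ### Non-degeneracy of the cup pairing of `Y(ℂ)` -/

/-- **A class cup-orthogonal to a whole complementary degree vanishes**: for `Y` smooth projective
of dimension `m`, `a + d = 2m`, and `u ∈ Hᵃ(Y(ℂ); ℂ)` with `u ∪ w = 0` for every
`w ∈ Hᵈ(Y(ℂ); ℂ)`, one has `u = 0` — the cup product pairing `(u, w) ↦ ⟨u ∪ w, [Y(ℂ)]⟩` of the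
closed oriented manifold `Y(ℂ)` is perfect (Hatcher Prop. 3.38; the tree's
`isPerfPair_cupPairing_complexPoints`), so its left map is injective.
[cite: HatcherAT2002, §3.3 Prop. 3.38] -/
theorem complexBetti_eq_zero_of_forall_cupProduct_eq_zero {m a d : ℕ} {Y : SchemeOver ℂ}
    (hY : IsSmoothProjective m Y) (had : a + d = 2 * m) {u : complexBetti Y a}
    (hu : ∀ w : complexBetti Y d, cupProduct had u w = 0) : u = 0 := by
  -- the cup pairing is perfect: test `u` against all classes of degree `d`
  apply
    (isPerfPair_cupPairing_complexPoints complexOrientationFamily hY had).bijective_left.injective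
  rw [map_zero]
  refine LinearMap.ext fun w ↦ ?_
  rw [cupPairing_apply, hu w, map_zero, LinearMap.zero_apply, LinearMap.zero_apply]

/-! ### The stub -/

/-- **Stub `stub_transversal_aboveMiddle` of the crux `ThickDescent`** — ABOVE THE MIDDLE A
PULL-BACK ORTHOGONAL TO ALL PULL-BACKS VANISHES: for `f : Y ⟶ X` with `Y` smooth projective of
dimension `m`, `2p + k = 2m`, `x ∈ H^{2p}(X(ℂ); ℂ)`, `f^* : Hᵏ(X(ℂ); ℂ) → Hᵏ(Y(ℂ); ℂ)` surjective
(weak Lefschetz, a hypothesis here) and `f^* x ∪ f^* y = 0` for all `y ∈ Hᵏ(X(ℂ); ℂ)`: `f^* x = 0`.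
Proof: every `w ∈ Hᵏ(Y(ℂ); ℂ)` is an `f^* y`, so `f^* x ∪ w = 0` for all `w`, and Poincaré duality
on `Y(ℂ)` (the perfect cup pairing, `complexBetti_eq_zero_of_forall_cupProduct_eq_zero`) forces
`f^* x = 0`.
[cite: HatcherAT2002, §3.3 Prop. 3.38] [cite: VoisinHodgeII2003, §1.2.2 Thm. 1.23] -/
theorem stub_transversal_aboveMiddle :
    ∀ ⦃m p k : ℕ⦄ ⦃X Y : SchemeOver ℂ⦄ (f : Y ⟶ X) (hY : IsSmoothProjective m Y)
      (hk : 2 * p + k = 2 * m) (x : complexBetti X (2 * p)),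
      Function.Surjective (complexBetti.map f k) →
      (∀ y : complexBetti X k,
        cupProduct hk (complexBetti.map f (2 * p) x) (complexBetti.map f k y) = 0) →
      complexBetti.map f (2 * p) x = 0 := by
  intro m p k X Y f hY hk x hsurj horth
  refine complexBetti_eq_zero_of_forall_cupProduct_eq_zero hY hk fun w ↦ ?_
  -- `w = f^* y` for some `y ∈ Hᵏ(X(ℂ); ℂ)` by surjectivity
  obtain ⟨y, rfl⟩ := hsurj w
  exact horth y

end Summit.HodgeConjecture.HodgeConjecture.Theorems

end
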